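import Literature.AlgebraicGeometry.Resolution.Hironaka1964LocalCharts
import HarnessLib

/-!
# `Hironaka1964_local` reduces to blow-ups of quasi-excellent affine domains centred in a principal divisor

Topic: `Literature/AlgebraicGeometry/Resolution`. Companion of `Hironaka1964LocalCharts.lean`
(proofs only: no new notions, no new named facts). There the named fact `Hironaka1964_local`
(Hironaka 1964, Main Theorem I, over local quasi-excellent rings of residue characteristic zero,
as read by Temkin 2008) was reduced (`hironaka1964_local_of_charts`) to the chart-local core of
Temkin's proof of Thm. 3.4.1,

  (C₀) for an integral Noetherian quasi-excellent scheme `X` with residue fields of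
       characteristic zero, an effective Cartier divisor `D ⊇ X_sing` of finite type over a
       field, an affine open `U ⊆ X` on which `D` is generated by one non-zero-divisor `g`, and
       a `D`-supported blow-up `p : X' → X`, the open piece `p⁻¹(U)` admits a desingularization.

Over the affine chart `U = Spec A` everything in (C₀) is a statement about the ring `A = Γ(X, U)`
(Temkin, proof of Thm. 3.4.1, p. 18: "Find an open affine subscheme `𝔛₀` which possesses a
principal ideal of definition … `𝔛'₀ = 𝔛₀ ×_𝔛 𝔛'` … the induced formal blow up"): `A` is a
quasi-excellent domain, the points of `Spec A` have residue fields of characteristic zero,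
`A[1/g]` is regular (`U ∖ D ⊆ X_reg`), `A/gA = Γ(D ∩ U)` is of finite type over the field, and
`p⁻¹(U) → U ≅ Spec A` is a blow-up of `Spec A` centred in `V(g)`. This file performs that
translation, sorry-free, reducing (C₀) — hence `Hironaka1964_local` — to the purely affine

  (A) **the principal affine case**: for every quasi-excellent domain `A` containing `ℚ` (every
      nonzero integer a unit: all residue fields have characteristic zero), every `g ∈ A` with
      `A_𝔭` regular for all primes `𝔭 ∌ g`, such that `A/gA` is of finite type over some field,
      and every blow-up `q : Y → Spec A` along an ideal sheaf supported in `V(g)`, the scheme `Y`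
      admits a desingularization

— the input of the local step of Thm. 3.4.1 (`g`-adic completion of `A`, algebraization
Prop. 3.3.1, resolution of varieties in characteristic zero), now free of the ambient `X`.

* `charts_of_affine` — **(A) ⟹ (C₀)**: for `U ≠ ∅`, `A = Γ(X, U)` is a domain (`X` integral) and
  quasi-excellent (`X` is); a nonzero integer `n` lies in no maximal ideal `𝔪` of `A`, being
  nonzero in the characteristic-zero residue field of the point `x ∈ U` corresponding to `𝔪`
  while `x ∉ X(n)` (`Scheme.evaluation_eq_zero_iff_notMem_basicOpen`), so `A ⊇ ℚ`; for `𝔭 ∌ g` the point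
  of `U` lies in `X(g) ⊆ U ∖ D ⊆ X_reg` (`mem_support_iff_of_mem`, `fromSpec_preimage_basicOpen`,
  `mem_regularLocus_fromSpec_iff`); `A/gA ≅ Γ(X, U)/D(U)` receives a finite type ring map from
  the field through `Spec(Γ(X, U)/D(U)) → D → Spec k` (`subschemeCover`, `Spec.preimage`,
  `HasRingHomProperty.Spec_iff`); and `p⁻¹(U) → U ≅ Spec A` is a blow-up along `P|_U`
  (`IsBlowup.restrict`, `IsBlowup.comp_iso`) whose centre lies over `Supp P ⊆ Supp D`, i.e. in
  `V(g)`. The empty chart is regular.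
* `hironaka1964_local_of_affine` — **(A) ⟹ `Hironaka1964_local`**
  (with `hironaka1964_local_of_charts`).

No named fact is introduced: (A) appears only as a hypothesis.

## Sources

* M. Temkin, *Desingularization of quasi-excellent schemes in characteristic zero*, Adv. Math.
  219 (2008) 488–522 = arXiv:math/0703678 (arXiv pagination): Thm. 3.4.1 and its proof (p. 18),
  Cor. 3.4.2, Thm. 3.4.3 (p. 19). [Temkin2008]
* H. Hironaka, *Resolution of singularities of an algebraic variety over a field of
  characteristic zero I*, Ann. of Math. 79 (1964) 109–203, Main Theorem I. [Hironaka1964]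
-/

noncomputable section

open CategoryTheory CategoryTheory.Limits AlgebraicGeometry TopologicalSpace IsLocalRing

namespace Literature.AlgebraicGeometry.Resolution

universe u

/-- **The principal affine case (A) implies the chart-local case (C₀)** (Temkin 2008, proof of
Thm. 3.4.1, p. 18, the passage to the affine chart `𝔛₀` with principal ideal of definition):
for `X` integral Noetherian quasi-excellent with residue fields of characteristic zero, `D` an
effective Cartier divisor containing `X_sing` and of finite type over a field `k`, `U = Spec A`
an affine open with `D(U) = (g)`, and `p : X' → X` a blow-up centred in `Supp D`: `A` is a
quasi-excellent domain whose spectrum has residue fields of characteristic zero (those of `X`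
along the open immersion `Spec A → X`, so that every nonzero integer is a unit of `A`), `A_𝔭` is regular for `𝔭 ∌ g` (the corresponding point
of `U` lies in `X(g)`, off `D ⊇ X_sing`), `A/gA = Γ(X, U)/D(U)` is of finite type over `k`
(through `Spec(A/gA) → D → Spec k`), and `p⁻¹(U) → U ≅ Spec A` is a blow-up centred in `V(g)`;
so (A) desingularizes `p⁻¹(U)`. [cite: Temkin2008, Thm. 3.4.1 (proof, p. 18)] -/
theorem charts_of_affine
    (haff : ∀ (A : Type u) [CommRing A] [IsDomain A], IsQuasiExcellentRing A →
      (∀ n : ℕ, n ≠ 0 → IsUnit (n : A)) →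
      ∀ (g : A), (∀ P : PrimeSpectrum A, g ∉ P.asIdeal → P ∈ regularLocus A) →
        (∃ (k : Type u) (_ : Field k) (_ : Algebra k (A ⧸ Ideal.span {g})),
            Algebra.FiniteType k (A ⧸ Ideal.span {g})) →
        ∀ (Y : Scheme.{u}) (q : Y ⟶ Spec (.of A)) (Q : (Spec (.of A)).IdealSheafData),
          IsBlowup q Q → (∀ y ∈ Q.support, g ∈ y.asIdeal) →
          Scheme.AdmitsDesingularization Y)
    (X : Scheme.{u}) [IsIntegral X] [IsNoetherian X] (hqe : Scheme.IsQuasiExcellent X)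
    (hchar : ∀ x : X, CharZero (X.residueField x)) (D : X.IdealSheafData)
    (_hD : IsEffectiveCartier D) (hsingD : (Scheme.regularLocus X)ᶜ ⊆ (D.support : Set X))
    (hfin : ∃ (k : Type u) (_ : Field k) (q : D.subscheme ⟶ Spec (.of k)),
      LocallyOfFiniteType q ∧ QuasiCompact q)
    (U : X.affineOpens)
    (hg : ∃ g : Γ(X, U), g ∈ nonZeroDivisors Γ(X, U) ∧ D.ideal U = Ideal.span {g})
    (X' : Scheme.{u}) (p : X' ⟶ X) (P : X.IdealSheafData) (hp : IsBlowup p P)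
    (hP : (P.support : Set X) ⊆ D.support) :
    Scheme.AdmitsDesingularization (↑(p ⁻¹ᵁ (U : X.Opens)) : Scheme.{u}) := by
  obtain ⟨g, -, hDU⟩ := hg
  have hU : IsAffineOpen (U : X.Opens) := U.2
  -- the empty chart is empty, hence regular
  by_cases hne : Nonempty (U : X.Opens)
  swap
  · haveI : IsEmpty (↑(p ⁻¹ᵁ (U : X.Opens)) : Scheme.{u}) :=
      ⟨fun x => hne ⟨⟨p x.1, x.2⟩⟩⟩
    exact Scheme.admitsDesingularization_of_isEmpty _
  haveI := hne
  -- a point `fromSpec y` of `U` lies in `Supp D` iff `g ∈ y`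
  have hsuppD : ∀ y : Spec Γ(X, U), hU.fromSpec y ∈ (D.support : Set X) → g ∈ y.asIdeal := by
    intro y hy
    have hmem : hU.fromSpec y ∈ (U : X.Opens) := hU.range_fromSpec.le ⟨y, rfl⟩
    have h2 := (Scheme.IdealSheafData.mem_support_iff_of_mem (I := D) (U := U) hmem).mp hy
    rw [Scheme.mem_zeroLocus_iff] at h2
    have h3 : hU.fromSpec y ∉ X.basicOpen g :=
      h2 g (by rw [hDU]; exact Ideal.mem_span_singleton_self g)
    by_contra hgy
    apply h3
    show y ∈ hU.fromSpec ⁻¹ᵁ X.basicOpen g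
    rw [IsAffineOpen.fromSpec_preimage_basicOpen]
    exact hgy
  -- `A = Γ(X, U)` is a quasi-excellent domain
  have hqeA : IsQuasiExcellentRing Γ(X, U) := hqe U
  -- `A` is a `ℚ`-algebra: a nonzero integer lies in no maximal ideal `𝔪`, being nonzero in the
  -- residue field (of characteristic zero) of the corresponding point of `U`
  have hunitA : ∀ n : ℕ, n ≠ 0 → IsUnit (n : Γ(X, U)) := by
    intro n hn
    by_contra hnu
    obtain ⟨M, hM, hnM⟩ := exists_max_ideal_of_mem_nonunits (mem_nonunits_iff.mpr hnu)
    let y : PrimeSpectrum Γ(X, U) := ⟨M, hM.isPrime⟩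
    have hmem : hU.fromSpec y ∈ (U : X.Opens) := hU.range_fromSpec.le ⟨y, rfl⟩
    haveI := hchar (hU.fromSpec y)
    have h0 : X.evaluation U (hU.fromSpec y) hmem (n : Γ(X, U)) = 0 := by
      rw [Scheme.evaluation_eq_zero_iff_notMem_basicOpen]
      intro hx
      have hy : y ∈ hU.fromSpec ⁻¹ᵁ X.basicOpen (n : Γ(X, U)) := hx
      rw [IsAffineOpen.fromSpec_preimage_basicOpen] at hy
      exact hy hnM
    rw [map_natCast] at h0
    exact hn (Nat.cast_eq_zero.mp h0)
  -- `A[1/g]` is regular: off `V(g)` the point of `U` is off `D ⊇ X_sing`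
  have hregA : ∀ y : PrimeSpectrum Γ(X, U), g ∉ y.asIdeal → y ∈ regularLocus Γ(X, U) := by
    intro y hgy
    rw [← mem_regularLocus_fromSpec_iff hU y]
    by_contra hsing
    exact hgy (hsuppD y (hsingD hsing))
  -- `A/gA ≅ Γ(X, U)/D(U)` is of finite type over the field `k`
  have hftA : ∃ (k : Type u) (_ : Field k) (_ : Algebra k (Γ(X, U) ⧸ Ideal.span {g})),
      Algebra.FiniteType k (Γ(X, U) ⧸ Ideal.span {g}) := by
    obtain ⟨k, _, q, hq, -⟩ := hfin
    let φ : Spec (D.subschemeCover.X U) ⟶ Spec (.of k) := D.subschemeCover.f U ≫ q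
    haveI : LocallyOfFiniteType φ := inferInstance
    have hφ : (Spec.preimage φ).hom.FiniteType := by
      apply (HasRingHomProperty.Spec_iff (P := @LocallyOfFiniteType)).mp
      rw [Spec.map_preimage]
      infer_instance
    let e : (Γ(X, U) ⧸ D.ideal U) ≃+* (Γ(X, U) ⧸ Ideal.span {g}) := Ideal.quotEquivOfEq hDU
    let ψ : k →+* (Γ(X, U) ⧸ Ideal.span {g}) := e.toRingHom.comp (Spec.preimage φ).hom
    exact ⟨k, inferInstance, ψ.toAlgebra,
      (RingHom.FiniteType.of_surjective _ e.surjective).comp hφ⟩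
  -- `p⁻¹(U) → U ≅ Spec A` is a blow-up along `P|_U`, centred in `V(g)`
  have hq : IsBlowup ((p ∣_ (U : X.Opens)) ≫ hU.isoSpec.hom)
      ((P.comap (U : X.Opens).ι).comap hU.isoSpec.inv) :=
    (hp.restrict _).comp_iso hU.isoSpec
  have hQ : ∀ y ∈ ((P.comap (U : X.Opens).ι).comap hU.isoSpec.inv).support, g ∈ y.asIdeal := by
    intro y hy
    rw [← Scheme.IdealSheafData.comap_comp, IsAffineOpen.isoSpec_inv_ι] at hy
    have hy' : hU.fromSpec y ∈ (P.support : Set X) := by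
      rw [Scheme.IdealSheafData.support_comap] at hy
      exact hy
    exact hsuppD y (hP hy')
  exact haff Γ(X, U) hqeA hunitA g hregA hftA _ _ _ hq hQ

/-- **The principal affine case (A) implies `Hironaka1964_local`**: resolution of singularities
over every local quasi-excellent ring of residue characteristic zero (Hironaka 1964, Main
Theorem I, as read by Temkin 2008) follows — through (L), the Cartier case (C), the chart
induction (C₀) and the affine translation — from the statement that for a quasi-excellent
domain `A ⊇ ℚ`, `g ∈ A` with `A_𝔭` regular for all
`𝔭 ∌ g` and `A/gA` of finite type over a field, every blow-up of `Spec A` centred in `V(g)`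
admits a desingularization (the local step of Temkin's Thm. 3.4.1: completion, algebraization,
resolution of varieties). [cite: Temkin2008, Thm. 3.4.3, Cor. 3.4.2, Thm. 3.4.1]
[cite: Hironaka1964, Main Theorem I] -/
theorem hironaka1964_local_of_affine
    (haff : ∀ (A : Type u) [CommRing A] [IsDomain A], IsQuasiExcellentRing A →
      (∀ n : ℕ, n ≠ 0 → IsUnit (n : A)) →
      ∀ (g : A), (∀ P : PrimeSpectrum A, g ∉ P.asIdeal → P ∈ regularLocus A) →
        (∃ (k : Type u) (_ : Field k) (_ : Algebra k (A ⧸ Ideal.span {g})),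
            Algebra.FiniteType k (A ⧸ Ideal.span {g})) →
        ∀ (Y : Scheme.{u}) (q : Y ⟶ Spec (.of A)) (Q : (Spec (.of A)).IdealSheafData),
          IsBlowup q Q → (∀ y ∈ Q.support, g ∈ y.asIdeal) →
          Scheme.AdmitsDesingularization Y) :
    Hironaka1964_local.{u} :=
  hironaka1964_local_of_charts fun X _ _ hqe hchar D hD hsingD hfin U hg X' p P hp hP =>
    charts_of_affine haff X hqe hchar D hD hsingD hfin U hg X' p P hp hP

end Literature.AlgebraicGeometry.Resolution

end
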